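import Summits.ResolutionOfSingularities.ResolutionOfSingularities.Theorems.FrobeniusClosingSteerBetaLetterPushIdent
import Literature.AlgebraicGeometry.Resolution.MonomialIdealsRegularParameters
import Mathlib.RingTheory.RegularLocalRing.Defs
import HarnessLib

/-!
# Crux `Steer` (stmt-ResolutionOfSingularities-16345), chain W4.1, β-LEAF (hK4′), K-β2♭ part (I), file 3: the THRESHOLD IDEALS
# ARE MONOMIAL IDEALS — `threshold ∩ 𝔪^d` keeps the degree — and the Y-LETTER / X-FACE laws at representative level (def-free)

OURS (campaign `res-hironaka`, rung L ★L-G4, slot W4.1; statements about the route's own objects; they replace the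
role of no printed item and are NOT statements of the manuscript under review [claim: Hironaka2017, status:
under-review]; AI review is weaker than expert review). Seat res-D-pv-003 (gen 6), K-β2♭ kernel owner (res-L0-w41-plan-1
RULINGS 143/148a/150 (2); res-L0-w41-idea-1 v18a `XLetterPushHat` / `YLetterPushHat`).

* §1 `uPow` bookkeeping for the family `![x, y, z, w]`.
* §2 `threshold_le_span_uPow` — every threshold ideal `(z,w)^d + Σ_{i+j<d} (x^a y^b z^i w^j : P(d−i−j, a, b))` is contained
  in the MONOMIAL ideal of `![x,y,z,w]` on the obvious exponent set; `span_four_pow_eq_span_uPow` — `(x,y,z,w)^d` likewise.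
* §3 **`mem_threshold_deg_of_mem_pow`** — for a regular local ring of dimension four with `(x, y, z, w) = 𝔪` and a threshold
  condition `P` monotone in the slot, `f ∈ threshold(P)` and `f ∈ (x,y,z,w)^d` give `f ∈ threshold(n ≤ a + b ∧ P)`: the
  intersection of two monomial ideals in a regular system of parameters is the monomial ideal of the joins
  (`CossartPiltant.span_uPow_inf_span_uPow`, Cossart–Piltant 2019 Prop. 2.1 calculus, tree). This is the «`AlphaGe ∩ 𝔪^d` is a
  monomial ideal» step of idea-1's `YLetterPushHat` docstring. The dimension hypothesis is NECESSARY: with `S = k⟦y,z,w⟧`,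
  `x := y²` (so `(x,y,z,w) = 𝔪`, `S` regular of dimension three), `d = 3`, `ρ = 1/3`, `f = y³ ∈ (x) ∩ 𝔪³` and the `y`-chart
  `z = y z₁, w = y w₁, x₁ = y`, one gets `f₁ = 1 ∉ 𝔪₁` although `AlphaGe x z w 3 (1/3) f` holds — so `YLetterPushHat` needs
  `ringKrullDim S = 4` (equivalently `IsRsopPart ![x,y,z,w]`) among its binders (reported to idea-1 / tri-2).
* §4 **Y-letter laws at representative level, from the WORD-shaped hypotheses**: `alpha_y_law` (`α ≥ ρ` & `f ∈ 𝔪^d` ⇒ `α₁ ≥ ρ`),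
  `beta_y_law` (column `(α, β ≥ ρ)` & `f ∈ 𝔪^d` ⇒ `β₁ ≥ α + ρ − 1` on the column `α`), conclusions in the `AlphaGe` / `BetaGe` BODY
  shape (the words file turns them into `BetaPolygon.AlphaGe` / `BetaGe` by `Iff.rfl`). [CJS LNM 2270 Lemma 12.2 (2)(3)]
* §5 **X-letter face law**: `deltaFace_le_poly` (idea-1's `DeltaFaceGe` body ⇒ the face region of `beta_x_letter`) and
  `beta_x_law_of_deltaFace` (`γ⁻ ≥ ρ` on the `δ`-face ⇒ `β₁ ≥ ρ` on the column `δ − 1`, `BetaGe` body shape). [CJS Lemma 12.1 (3)]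
No Theses file is imported; nothing here is a route item or a registration.
-/

noncomputable section

-- `Summit.<S>.<S>.…` duplicates the summit name by design (single-problem summit).
set_option linter.dupNamespace false

namespace Summit.ResolutionOfSingularities.ResolutionOfSingularities.Theorems.SwitchingDichotomy.BetaLetter

open IsLocalRing nonZeroDivisors
open Literature.AlgebraicGeometry.Resolution
open Literature.AlgebraicGeometry.Resolution.CossartPiltant (uPow uPow_mem_span_uPow span_uPow_inf_span_uPow
  span_range_pow_eq_span_uPow)

universe u

variable {S : Type u} [CommRing S] {S₁ : Type*} [CommRing S₁]

/-! ## §1 Monomials in the family `![x, y, z, w]` -/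

section UPow

omit [CommRing S] in
/-- The range of a four-term family. [folklore] -/
theorem range_four (x y z w : S) : Set.range ![x, y, z, w] = {x, y, z, w} := by
  ext t
  simp only [Set.mem_range, Set.mem_insert_iff, Set.mem_singleton_iff]
  constructor
  · rintro ⟨i, rfl⟩
    fin_cases i <;> simp
  · rintro (rfl | rfl | rfl | rfl)
    exacts [⟨0, rfl⟩, ⟨1, rfl⟩, ⟨2, rfl⟩, ⟨3, rfl⟩]

/-- `u^m = x^{m₀} y^{m₁} z^{m₂} w^{m₃}` for `u = ![x, y, z, w]`. [folklore] -/
theorem uPow_four (x y z w : S) (m : Fin 4 → ℕ) :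
    uPow ![x, y, z, w] m = x ^ m 0 * y ^ m 1 * z ^ m 2 * w ^ m 3 := by
  simp only [uPow, Fin.prod_univ_four, Matrix.cons_val_zero, Matrix.cons_val_one, Matrix.cons_val]

/-- The monomial `x^a y^b z^i w^j` as a `uPow`. [folklore] -/
theorem monomial_eq_uPow (x y z w : S) (a b i j : ℕ) :
    x ^ a * y ^ b * z ^ i * w ^ j = uPow ![x, y, z, w] ![a, b, i, j] := by
  rw [uPow_four]
  simp

end UPow

/-! ## §2 Threshold ideals are contained in monomial ideals -/

section Threshold

/-- The exponent set of a threshold ideal with slot condition `P (d − i − j) a b`. [folklore] -/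
theorem threshold_le_span_uPow (x y z w : S) (d : ℕ) (P : ℕ → ℕ → ℕ → Prop) :
    (Ideal.span {z, w} ^ d ⊔ ⨆ (i : ℕ) (j : ℕ) (_ : i + j < d) (a : ℕ) (b : ℕ) (_ : P (d - i - j) a b),
      Ideal.span {x ^ a * y ^ b * z ^ i * w ^ j}) ≤
    Ideal.span (uPow ![x, y, z, w] ''
      {m | d ≤ m 2 + m 3 ∨ (m 2 + m 3 < d ∧ P (d - m 2 - m 3) (m 0) (m 1))}) := by
  refine sup_le ?_ (iSup_le fun i => iSup_le fun j => iSup_le fun hij => iSup_le fun a => iSup_le fun b =>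
    iSup_le fun hP => ?_)
  · refine (span_pair_pow_le_iSup z w d).trans (iSup_le fun a => iSup_le fun b => iSup_le fun hab => ?_)
    rw [Ideal.span_singleton_le_iff_mem]
    have h : z ^ a * w ^ b = uPow ![x, y, z, w] ![0, 0, a, b] := by
      rw [← monomial_eq_uPow]; simp
    rw [h]
    refine uPow_mem_span_uPow _ (Or.inl ?_)
    simp [hab]
  · rw [Ideal.span_singleton_le_iff_mem, monomial_eq_uPow]
    refine uPow_mem_span_uPow _ (Or.inr ?_)
    simpa using ⟨hij, hP⟩

/-- `(x, y, z, w)^d` is the monomial ideal of the exponents of total degree `≥ d`. [folklore] -/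
theorem span_four_pow_eq_span_uPow (x y z w : S) (d : ℕ) :
    Ideal.span {x, y, z, w} ^ d = Ideal.span (uPow ![x, y, z, w] '' {m | d ≤ ∑ l, m l}) := by
  rw [← range_four, span_range_pow_eq_span_uPow]

/-- A monomial whose `(z, w)`-degree is at least `d` lies in `(z, w)^d`. [folklore] -/
theorem monomial_mem_pow_of_le (x y z w : S) {d a b i j : ℕ} (h : d ≤ i + j) :
    x ^ a * y ^ b * z ^ i * w ^ j ∈ Ideal.span ({z, w} : Set S) ^ d := by
  have hz : z ^ i ∈ Ideal.span ({z, w} : Set S) ^ i :=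
    Ideal.pow_mem_pow (Ideal.subset_span (by simp)) i
  have hw : w ^ j ∈ Ideal.span ({z, w} : Set S) ^ j :=
    Ideal.pow_mem_pow (Ideal.subset_span (by simp)) j
  have hzw : z ^ i * w ^ j ∈ Ideal.span ({z, w} : Set S) ^ d := by
    have := Ideal.mul_mem_mul hz hw
    rw [← pow_add] at this
    exact Ideal.pow_le_pow_right h this
  have : x ^ a * y ^ b * z ^ i * w ^ j = (x ^ a * y ^ b) * (z ^ i * w ^ j) := by ring
  rw [this]
  exact Ideal.mul_mem_left _ _ hzw

end Threshold

/-! ## §3 `threshold ∩ 𝔪^d` keeps the degree (regular local, dimension four) -/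

section Intersection

/-- **Threshold ideals intersected with `(x,y,z,w)^d`.** In a regular local ring of dimension four with
`(x, y, z, w) = 𝔪`, if `f` lies in the threshold ideal of a slot condition `P` that is monotone (weaker for smaller
slots and larger exponents) and `f ∈ (x,y,z,w)^d`, then `f` lies in the threshold ideal of `n ≤ a + b ∧ P n a b`: every
monomial of the expansion may be taken of total degree `≥ d`. (Monomial ideals in a regular system of parameters
intersect exponent-wise: Cossart–Piltant 2019, Prop. 2.1 calculus, tree `span_uPow_inf_span_uPow`.)
[cite: CossartPiltant2019, Prop. 2.1] [cite: Matsumura1987, Thm. 17.8] -/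
theorem mem_threshold_deg_of_mem_pow [IsLocalRing S] (hreg : IsRegularLocalRing S) (hdim : ringKrullDim S = 4)
    {x y z w : S} (hspan : Ideal.span {x, y, z, w} = maximalIdeal S) {d : ℕ} {P : ℕ → ℕ → ℕ → Prop}
    (hmono : ∀ n n' a a' b b', P n a b → n' ≤ n → a ≤ a' → b ≤ b' → P n' a' b') {f : S}
    (hf : f ∈ Ideal.span {z, w} ^ d ⊔ ⨆ (i : ℕ) (j : ℕ) (_ : i + j < d) (a : ℕ) (b : ℕ) (_ : P (d - i - j) a b),
      Ideal.span {x ^ a * y ^ b * z ^ i * w ^ j})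
    (hfd : f ∈ Ideal.span {x, y, z, w} ^ d) :
    f ∈ Ideal.span {z, w} ^ d ⊔ ⨆ (i : ℕ) (j : ℕ) (_ : i + j < d) (a : ℕ) (b : ℕ)
      (_ : d - i - j ≤ a + b ∧ P (d - i - j) a b), Ideal.span {x ^ a * y ^ b * z ^ i * w ^ j} := by
  classical
  have hd : (maximalIdeal S).spanFinrank = 4 := by
    have h := IsRegularLocalRing.spanFinrank_maximalIdeal (R := S)
    rw [hdim] at h
    exact_mod_cast h
  have H := mem_span_image_of_mul_mem_rsop hd ![x, y, z, w] (by rw [range_four, hspan])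
  have h1 := threshold_le_span_uPow x y z w d P hf
  have h2 : f ∈ Ideal.span (uPow ![x, y, z, w] '' {m | d ≤ ∑ l, m l}) := by
    rw [← span_four_pow_eq_span_uPow]; exact hfd
  have h := (span_uPow_inf_span_uPow _ H _ _).le (Ideal.mem_inf.mpr ⟨h1, h2⟩)
  refine (Ideal.span_le.mpr ?_) h
  rintro _ ⟨_, ⟨b, hb, c, hc, rfl⟩, rfl⟩
  simp only [Set.mem_setOf_eq] at hb hc
  rw [SetLike.mem_coe, uPow_four]
  simp only [Pi.sup_apply]
  have hb0 : b 0 ≤ b 0 ⊔ c 0 := le_sup_left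
  have hb1 : b 1 ≤ b 1 ⊔ c 1 := le_sup_left
  have hb2 : b 2 ≤ b 2 ⊔ c 2 := le_sup_left
  have hb3 : b 3 ≤ b 3 ⊔ c 3 := le_sup_left
  have hc0 : c 0 ≤ b 0 ⊔ c 0 := le_sup_right
  have hc1 : c 1 ≤ b 1 ⊔ c 1 := le_sup_right
  have hc2 : c 2 ≤ b 2 ⊔ c 2 := le_sup_right
  have hc3 : c 3 ≤ b 3 ⊔ c 3 := le_sup_right
  have hc' : d ≤ c 0 + c 1 + c 2 + c 3 := by simpa [Fin.sum_univ_four, add_assoc] using hc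
  generalize b 0 ⊔ c 0 = A at hb0 hc0 ⊢
  generalize b 1 ⊔ c 1 = B at hb1 hc1 ⊢
  generalize b 2 ⊔ c 2 = I at hb2 hc2 ⊢
  generalize b 3 ⊔ c 3 = J at hb3 hc3 ⊢
  by_cases hzw : d ≤ I + J
  · exact Ideal.mem_sup_left (monomial_mem_pow_of_le x y z w hzw)
  · push Not at hzw
    refine Ideal.mem_sup_right ?_
    refine Submodule.mem_iSup_of_mem I (Submodule.mem_iSup_of_mem J
      (Submodule.mem_iSup_of_mem hzw (Submodule.mem_iSup_of_mem A
        (Submodule.mem_iSup_of_mem B (Submodule.mem_iSup_of_mem ⟨by omega, ?_⟩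
          (Ideal.mem_span_singleton_self _))))))
    rcases hb with hb | ⟨hblt, hbP⟩
    · omega
    · exact hmono _ _ _ _ _ _ hbP (by omega) hb0 hb1

end Intersection

/-! ## §4 Y-letter laws at representative level (word-shaped hypotheses) -/

section YLaws

/-- Embedding of the `α`-threshold word shape into the slot-condition shape `⌈ρ n⌉ ≤ a` (any `b`). [folklore] -/
theorem alpha_le_threshold (x y z w : S) (d : ℕ) (ρ : ℚ) :
    (Ideal.span {z, w} ^ d ⊔ ⨆ (i : ℕ) (j : ℕ) (_ : i + j < d),
      Ideal.span {x ^ ⌈ρ * ((d - i - j : ℕ) : ℚ)⌉₊ * z ^ i * w ^ j}) ≤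
    Ideal.span {z, w} ^ d ⊔ ⨆ (i : ℕ) (j : ℕ) (_ : i + j < d) (a : ℕ) (b : ℕ)
      (_ : ⌈ρ * ((d - i - j : ℕ) : ℚ)⌉₊ ≤ a), Ideal.span {x ^ a * y ^ b * z ^ i * w ^ j} := by
  refine sup_le le_sup_left (iSup_le fun i => iSup_le fun j => iSup_le fun hij => ?_)
  refine le_sup_right.trans' (le_iSup_of_le i (le_iSup_of_le j (le_iSup_of_le hij
    (le_iSup_of_le _ (le_iSup_of_le 0 (le_iSup_of_le le_rfl ?_))))))
  exact Ideal.span_singleton_le_span_singleton.mpr ⟨1, by ring⟩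

/-- Embedding of the `β`-threshold word shape into the slot-condition shape. [folklore] -/
theorem beta_le_threshold (x y z w : S) (d : ℕ) (α ρ : ℚ) :
    (Ideal.span {z, w} ^ d ⊔ ⨆ (i : ℕ) (j : ℕ) (_ : i + j < d),
      (Ideal.span {x ^ (⌊α * ((d - i - j : ℕ) : ℚ)⌋₊ + 1) * z ^ i * w ^ j} ⊔
        Ideal.span {x ^ ⌈α * ((d - i - j : ℕ) : ℚ)⌉₊ * y ^ ⌈ρ * ((d - i - j : ℕ) : ℚ)⌉₊ * z ^ i * w ^ j})) ≤
    Ideal.span {z, w} ^ d ⊔ ⨆ (i : ℕ) (j : ℕ) (_ : i + j < d) (a : ℕ) (b : ℕ)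
      (_ : ⌊α * ((d - i - j : ℕ) : ℚ)⌋₊ + 1 ≤ a ∨
        (⌈α * ((d - i - j : ℕ) : ℚ)⌉₊ ≤ a ∧ ⌈ρ * ((d - i - j : ℕ) : ℚ)⌉₊ ≤ b)),
      Ideal.span {x ^ a * y ^ b * z ^ i * w ^ j} := by
  refine sup_le le_sup_left (iSup_le fun i => iSup_le fun j => iSup_le fun hij => sup_le ?_ ?_)
  · refine le_sup_right.trans' (le_iSup_of_le i (le_iSup_of_le j (le_iSup_of_le hij
      (le_iSup_of_le _ (le_iSup_of_le 0 (le_iSup_of_le (Or.inl le_rfl) ?_))))))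
    exact Ideal.span_singleton_le_span_singleton.mpr ⟨1, by ring⟩
  · refine le_sup_right.trans' (le_iSup_of_le i (le_iSup_of_le j (le_iSup_of_le hij
      (le_iSup_of_le _ (le_iSup_of_le _ (le_iSup_of_le (Or.inr ⟨le_rfl, le_rfl⟩) le_rfl))))))

/-- Monotonicity of `n ↦ ⌈ρ n⌉₊` for `0 ≤ ρ`. [folklore] -/
theorem ceil_mul_mono {ρ : ℚ} (hρ : 0 ≤ ρ) {n n' : ℕ} (h : n' ≤ n) :
    ⌈ρ * (n' : ℚ)⌉₊ ≤ ⌈ρ * (n : ℚ)⌉₊ :=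
  Nat.ceil_mono (mul_le_mul_of_nonneg_left (by exact_mod_cast h) hρ)

/-- Monotonicity of `n ↦ ⌊ρ n⌋₊` for `0 ≤ ρ`. [folklore] -/
theorem floor_mul_mono {ρ : ℚ} (hρ : 0 ≤ ρ) {n n' : ℕ} (h : n' ≤ n) :
    ⌊ρ * (n' : ℚ)⌋₊ ≤ ⌊ρ * (n : ℚ)⌋₊ :=
  Nat.floor_mono (mul_le_mul_of_nonneg_left (by exact_mod_cast h) hρ)

/-- **Y-letter `α`-law from the word shape** («`α(f) ≥ ρ`, `f ∈ 𝔪^d` ⇒ `α(f₁) ≥ ρ`», CJS 12.2 (2), push-forward half):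
in a four-dimensional regular local ring with `(x,y,z,w) = 𝔪`, along `φ x = φ y · x₁`, `φ z = φ y · z₁`, `φ w = φ y · w₁`,
`φ f = (φ y)^d · f₁`, `φ y` a non-zero-divisor. The output is in the `AlphaGe x₁ z₁ w₁ d ρ` body shape.
[cite: CossartJannsenSaito2020, Lemma 12.2] -/
theorem alpha_y_law [IsLocalRing S] (hreg : IsRegularLocalRing S) (hdim : ringKrullDim S = 4)
    {x y z w f : S} (hspan : Ideal.span {x, y, z, w} = maximalIdeal S) (φ : S →+* S₁) {x₁ z₁ w₁ f₁ : S₁} {d : ℕ}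
    (hy : φ y ∈ S₁⁰) (hx : φ x = φ y * x₁) (hz : φ z = φ y * z₁) (hw : φ w = φ y * w₁)
    (hf : φ f = φ y ^ d * f₁) (hfd : f ∈ maximalIdeal S ^ d) {ρ : ℚ} (hρ : 0 ≤ ρ)
    (hα : f ∈ Ideal.span {z, w} ^ d ⊔ ⨆ (i : ℕ) (j : ℕ) (_ : i + j < d),
      Ideal.span {x ^ ⌈ρ * ((d - i - j : ℕ) : ℚ)⌉₊ * z ^ i * w ^ j}) :
    f₁ ∈ Ideal.span {z₁, w₁} ^ d ⊔ ⨆ (i : ℕ) (j : ℕ) (_ : i + j < d),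
      Ideal.span {x₁ ^ ⌈ρ * ((d - i - j : ℕ) : ℚ)⌉₊ * z₁ ^ i * w₁ ^ j} := by
  rw [← hspan] at hfd
  have h := mem_threshold_deg_of_mem_pow hreg hdim hspan (P := fun n a _ => ⌈ρ * (n : ℚ)⌉₊ ≤ a)
    (fun n n' a a' b b' h hn ha _ => (ceil_mul_mono hρ hn).trans (h.trans ha)) (alpha_le_threshold x y z w d ρ hα) hfd
  exact poly_alpha_le' x₁ (φ y) z₁ w₁ d ρ (alpha_y_letter φ hy hx hz hw hf h)

/-- **Y-letter `β`-law from the word shape** («column `(α, β ≥ ρ)`, `f ∈ 𝔪^d` ⇒ `β(f₁) ≥ α + ρ − 1` on the column `α`»,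
CJS 12.2 (3), push-forward half), `0 ≤ α`, `0 ≤ ρ`; output in the `BetaGe x₁ (φ y) z₁ w₁ d α (α + ρ − 1)` body shape.
[cite: CossartJannsenSaito2020, Lemma 12.2] -/
theorem beta_y_law [IsLocalRing S] (hreg : IsRegularLocalRing S) (hdim : ringKrullDim S = 4)
    {x y z w f : S} (hspan : Ideal.span {x, y, z, w} = maximalIdeal S) (φ : S →+* S₁) {x₁ z₁ w₁ f₁ : S₁} {d : ℕ}
    (hy : φ y ∈ S₁⁰) (hx : φ x = φ y * x₁) (hz : φ z = φ y * z₁) (hw : φ w = φ y * w₁)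
    (hf : φ f = φ y ^ d * f₁) (hfd : f ∈ maximalIdeal S ^ d) {α ρ : ℚ} (hα0 : 0 ≤ α) (hρ : 0 ≤ ρ)
    (hβ : f ∈ Ideal.span {z, w} ^ d ⊔ ⨆ (i : ℕ) (j : ℕ) (_ : i + j < d),
      (Ideal.span {x ^ (⌊α * ((d - i - j : ℕ) : ℚ)⌋₊ + 1) * z ^ i * w ^ j} ⊔
        Ideal.span {x ^ ⌈α * ((d - i - j : ℕ) : ℚ)⌉₊ * y ^ ⌈ρ * ((d - i - j : ℕ) : ℚ)⌉₊ * z ^ i * w ^ j})) :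
    f₁ ∈ Ideal.span {z₁, w₁} ^ d ⊔ ⨆ (i : ℕ) (j : ℕ) (_ : i + j < d),
      (Ideal.span {x₁ ^ (⌊α * ((d - i - j : ℕ) : ℚ)⌋₊ + 1) * z₁ ^ i * w₁ ^ j} ⊔
        Ideal.span {x₁ ^ ⌈α * ((d - i - j : ℕ) : ℚ)⌉₊ * φ y ^ ⌈(α + ρ - 1) * ((d - i - j : ℕ) : ℚ)⌉₊ *
          z₁ ^ i * w₁ ^ j}) := by
  rw [← hspan] at hfd
  have h := mem_threshold_deg_of_mem_pow hreg hdim hspan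
    (P := fun n a b => ⌊α * (n : ℚ)⌋₊ + 1 ≤ a ∨ (⌈α * (n : ℚ)⌉₊ ≤ a ∧ ⌈ρ * (n : ℚ)⌉₊ ≤ b))
    (fun n n' a a' b b' h hn ha hb => by
      rcases h with h | ⟨h₁, h₂⟩
      · exact Or.inl ((Nat.add_le_add_right (floor_mul_mono hα0 hn) 1).trans (h.trans ha))
      · exact Or.inr ⟨(ceil_mul_mono hα0 hn).trans (h₁.trans ha), (ceil_mul_mono hρ hn).trans (h₂.trans hb)⟩)
    (beta_le_threshold x y z w d α ρ hβ) hfd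
  exact poly_beta_le x₁ (φ y) z₁ w₁ d α (α + ρ - 1) (beta_y_letter φ hy hx hz hw hf h)

end YLaws

/-! ## §5 X-letter: the `δ`-face region -/

section XFace

/-- idea-1's `DeltaFaceGe x y z w d δ ρ` body («every point has `a + b > δ`, or `a + b = δ ∧ b ≥ ρ`») IS contained in the
face region of `beta_x_letter` (`⌊δ n⌋ + 1 ≤ a + b ∨ (a + b = δ n ∧ ρ n ≤ b)`), for `0 ≤ δ`. [folklore] -/
theorem deltaFace_le_poly (x y z w : S) (d : ℕ) {δ : ℚ} (hδ : 0 ≤ δ) (ρ : ℚ) :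
    (Ideal.span {z, w} ^ d ⊔ ⨆ (i : ℕ) (j : ℕ) (_ : i + j < d),
      (Ideal.span {x, y} ^ (⌊δ * ((d - i - j : ℕ) : ℚ)⌋₊ + 1) ⊔
        Ideal.span {y ^ ⌈ρ * ((d - i - j : ℕ) : ℚ)⌉₊} *
          Ideal.span {x, y} ^ (⌈δ * ((d - i - j : ℕ) : ℚ)⌉₊ - ⌈ρ * ((d - i - j : ℕ) : ℚ)⌉₊)) *
        Ideal.span {z ^ i * w ^ j}) ≤
    Ideal.span {z, w} ^ d ⊔ ⨆ (i : ℕ) (j : ℕ) (_ : i + j < d) (a : ℕ) (b : ℕ)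
      (_ : ⌊δ * ((d - i - j : ℕ) : ℚ)⌋₊ + 1 ≤ a + b ∨
        (((a + b : ℕ) : ℚ) = δ * ((d - i - j : ℕ) : ℚ) ∧ ρ * ((d - i - j : ℕ) : ℚ) ≤ b)),
      Ideal.span {x ^ a * y ^ b * z ^ i * w ^ j} := by
  refine sup_le le_sup_left (iSup_le fun i => iSup_le fun j => iSup_le fun hij => ?_)
  refine le_sup_right.trans' (le_iSup_of_le i (le_iSup_of_le j (le_iSup_of_le hij ?_)))
  set n : ℕ := d - i - j with hn
  rw [Ideal.sup_mul]
  refine sup_le ?_ ?_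
  · -- `(x,y)^(⌊δn⌋+1) · z^i w^j`
    refine (Ideal.mul_mono_left (span_pair_pow_le_iSup x y _)).trans ?_
    rw [Ideal.iSup_mul]
    refine iSup_le fun a => ?_
    rw [Ideal.iSup_mul]
    refine iSup_le fun b => ?_
    rw [Ideal.iSup_mul]
    refine iSup_le fun hab => ?_
    rw [Ideal.span_singleton_mul_span_singleton]
    refine le_iSup_of_le a (le_iSup_of_le b (le_iSup_of_le (Or.inl hab.ge) ?_))
    exact Ideal.span_singleton_le_span_singleton.mpr ⟨1, by ring⟩
  · -- `y^⌈ρn⌉ · (x,y)^(⌈δn⌉ − ⌈ρn⌉) · z^i w^j`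
    rw [Ideal.mul_assoc]
    refine (Ideal.mul_mono_right (Ideal.mul_mono_left (span_pair_pow_le_iSup x y _))).trans ?_
    rw [Ideal.iSup_mul, Ideal.mul_iSup]
    refine iSup_le fun a => ?_
    rw [Ideal.iSup_mul, Ideal.mul_iSup]
    refine iSup_le fun b => ?_
    rw [Ideal.iSup_mul, Ideal.mul_iSup]
    refine iSup_le fun hab => ?_
    rw [Ideal.span_singleton_mul_span_singleton, Ideal.span_singleton_mul_span_singleton]
    have key : ⌊δ * (n : ℚ)⌋₊ + 1 ≤ a + (⌈ρ * (n : ℚ)⌉₊ + b) ∨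
        (((a + (⌈ρ * (n : ℚ)⌉₊ + b) : ℕ) : ℚ) = δ * (n : ℚ) ∧ ρ * (n : ℚ) ≤ ((⌈ρ * (n : ℚ)⌉₊ + b : ℕ) : ℚ)) := by
      by_cases h1 : ⌊δ * (n : ℚ)⌋₊ + 1 ≤ a + (⌈ρ * (n : ℚ)⌉₊ + b)
      · exact Or.inl h1
      · right
        push Not at h1
        have hδn : 0 ≤ δ * (n : ℚ) := mul_nonneg hδ (Nat.cast_nonneg _)
        have hfc : ⌊δ * (n : ℚ)⌋₊ ≤ ⌈δ * (n : ℚ)⌉₊ := Nat.floor_le_ceil _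
        have hcf : ⌈δ * (n : ℚ)⌉₊ ≤ ⌊δ * (n : ℚ)⌋₊ := by omega
        have hfloor : (⌊δ * (n : ℚ)⌋₊ : ℚ) ≤ δ * (n : ℚ) := Nat.floor_le hδn
        have hceil : δ * (n : ℚ) ≤ (⌈δ * (n : ℚ)⌉₊ : ℚ) := Nat.le_ceil _
        have hcf' : (⌈δ * (n : ℚ)⌉₊ : ℚ) ≤ (⌊δ * (n : ℚ)⌋₊ : ℚ) := by exact_mod_cast hcf
        have heq : a + (⌈ρ * (n : ℚ)⌉₊ + b) = ⌈δ * (n : ℚ)⌉₊ := by omega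
        refine ⟨?_, ?_⟩
        · rw [heq]; linarith
        · push_cast
          linarith [Nat.le_ceil (ρ * (n : ℚ)), (Nat.cast_nonneg b : (0 : ℚ) ≤ b)]
    refine le_iSup_of_le a (le_iSup_of_le (⌈ρ * (n : ℚ)⌉₊ + b) (le_iSup_of_le key ?_))
    exact Ideal.span_singleton_le_span_singleton.mpr ⟨1, by ring⟩

/-- **X-letter face law from the word shape** («`γ⁻ ≥ ρ` on the `δ`-face of `f` ⇒ `β(f₁) ≥ ρ` on the column `a = δ − 1`»,
CJS 12.1 (3)), `1 ≤ δ`; along `φ y = φ x · v₁`, `φ z = φ x · z₁`, `φ w = φ x · w₁`, `φ f = (φ x)^d · f₁`, `φ x` a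
non-zero-divisor; output in the `BetaGe (φ x) v₁ z₁ w₁ d (δ − 1) ρ` body shape. [cite: CossartJannsenSaito2020, Lemma 12.1] -/
theorem beta_x_law_of_deltaFace (φ : S →+* S₁) {x y z w f : S} {v₁ z₁ w₁ f₁ : S₁} {d : ℕ}
    (hx : φ x ∈ S₁⁰) (hy : φ y = φ x * v₁) (hz : φ z = φ x * z₁) (hw : φ w = φ x * w₁)
    (hf : φ f = φ x ^ d * f₁) {δ ρ : ℚ} (hδ : 1 ≤ δ)
    (hface : f ∈ Ideal.span {z, w} ^ d ⊔ ⨆ (i : ℕ) (j : ℕ) (_ : i + j < d),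
      (Ideal.span {x, y} ^ (⌊δ * ((d - i - j : ℕ) : ℚ)⌋₊ + 1) ⊔
        Ideal.span {y ^ ⌈ρ * ((d - i - j : ℕ) : ℚ)⌉₊} *
          Ideal.span {x, y} ^ (⌈δ * ((d - i - j : ℕ) : ℚ)⌉₊ - ⌈ρ * ((d - i - j : ℕ) : ℚ)⌉₊)) *
        Ideal.span {z ^ i * w ^ j}) :
    f₁ ∈ Ideal.span {z₁, w₁} ^ d ⊔ ⨆ (i : ℕ) (j : ℕ) (_ : i + j < d),
      (Ideal.span {φ x ^ (⌊(δ - 1) * ((d - i - j : ℕ) : ℚ)⌋₊ + 1) * z₁ ^ i * w₁ ^ j} ⊔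
        Ideal.span {φ x ^ ⌈(δ - 1) * ((d - i - j : ℕ) : ℚ)⌉₊ * v₁ ^ ⌈ρ * ((d - i - j : ℕ) : ℚ)⌉₊ *
          z₁ ^ i * w₁ ^ j}) :=
  poly_beta_le (φ x) v₁ z₁ w₁ d (δ - 1) ρ
    (beta_x_letter φ hx hy hz hw hf hδ (deltaFace_le_poly x y z w d (zero_le_one.trans hδ) ρ hface))

end XFace

end Summit.ResolutionOfSingularities.ResolutionOfSingularities.Theorems.SwitchingDichotomy.BetaLetter

end
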